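import Mathlib.Algebra.Polynomial.Roots
import Mathlib.Analysis.Polynomial.Basic
import Mathlib.Topology.Algebra.Polynomial
import HarnessLib

/-!
# Venture YMGap, track (b) census — sign changes of a real polynomial on `(0, ∞)` and the
# «sign-at-the-ends» parity lemma: a negative germ at `0⁺` forces #sign changes ≡ [leading coefficient > 0] (mod 2)

HONEST FRAMING: venture file of the cell `pub-ymgap` (QuantumFields programme); elementary real-polynomial facts, no physics.
This is the mechanism N-3 (iii) of HOME/STRUCTURE.md made a theorem: for the census polynomial `N` the germ law (G)
(`N(s) = −2Pn s^{P−1} + …`, negative at `0⁺`) and the leading-sign law (S∞) (`sign lc N = (−1)^n`) together FORCE the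
count-parity law (P) («#sign changes of `N` on `(0, ∞)` is odd iff `n` is even»); `Conjectures/TwistCensusParity.lean`
records the corollary `parityLaw_of_germLaw_of_leadingSignLaw`.

* `positiveSignChanges p` — the number of sign changes of `s ↦ p(s)` on `(0, ∞)`, defined as the number of distinct
  positive roots of `p` of odd multiplicity (`0` for `p = 0`).
* `odd_positiveSignChanges_iff_leadingCoeff_pos` — if `p.coeff i = 0` for `i < k` and `p.coeff k < 0` (negative germ),
  then `Odd (positiveSignChanges p) ↔ 0 < p.leadingCoeff`.
Proof: factor `p = F · g` with `F = ∏_{a ∈ S} (X − a)` over the multiset `S` of positive roots; `g` has no positive root,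
hence constant sign on `(0, ∞)` (intermediate value theorem); `F > 0` beyond `max S` and `sign F = (−1)^{|S|}` below `min S`;
compare with the signs of `p` near `0⁺` (germ) and at `+∞` (leading coefficient); `|S| ≡ #{odd-multiplicity roots} (mod 2)`.
[folklore]
-/

noncomputable section

open Polynomial Filter Topology
open scoped BigOperators

namespace Summit.Ventures.YMGap.Census

/-- **The number of sign changes of a real polynomial on `(0, ∞)`** = the number of its distinct positive roots of
odd multiplicity (for the zero polynomial: `0`).  The census decides it by Sturm chains / Vincent–Collins–Akritas /
Descartes certificates on the primitive integer scaling of `N_V` (all positive roots of record are simple). [folklore] -/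
def positiveSignChanges (p : ℝ[X]) : ℕ :=
  (p.roots.toFinset.filter fun r => 0 < r ∧ Odd (p.rootMultiplicity r)).card

/-! ### Plumbing: products over multisets of reals -/

/-- A product of positive reals over a multiset is positive. [folklore] -/
private theorem multiset_prod_map_pos (s : Multiset ℝ) (f : ℝ → ℝ) (h : ∀ a ∈ s, 0 < f a) :
    0 < (s.map f).prod := by
  induction s using Multiset.induction_on with
  | empty => simp
  | cons a s ih =>
    rw [Multiset.map_cons, Multiset.prod_cons]
    exact mul_pos (h a (Multiset.mem_cons_self a s)) (ih fun b hb => h b (Multiset.mem_cons_of_mem hb))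

/-- `∏_{a ∈ s} (x − a) = (−1)^{|s|} ∏_{a ∈ s} (a − x)`. [folklore] -/
private theorem multiset_prod_map_sub (s : Multiset ℝ) (x : ℝ) :
    (s.map fun a => x - a).prod = (-1 : ℝ) ^ Multiset.card s * (s.map fun a => a - x).prod := by
  induction s using Multiset.induction_on with
  | empty => simp
  | cons a s ih =>
    rw [Multiset.map_cons, Multiset.prod_cons, Multiset.map_cons, Multiset.prod_cons, Multiset.card_cons, ih, pow_succ]
    ring

/-- The product `∏_{a ∈ s} (X − a)` evaluates at `x` to `∏_{a ∈ s} (x − a)`. [folklore] -/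
private theorem eval_multiset_prod_X_sub_C (s : Multiset ℝ) (x : ℝ) :
    ((s.map fun a => X - C a).prod).eval x = (s.map fun a => x - a).prod := by
  rw [eval_multiset_prod, Multiset.map_map]
  congr 1
  exact Multiset.map_congr rfl fun a _ => by simp

/-- Parity of a finite sum of naturals = parity of the number of its odd terms. [folklore] -/
private theorem odd_sum_iff_odd_card_filter_odd {ι : Type*} (s : Finset ι) (f : ι → ℕ) :
    Odd (∑ i ∈ s, f i) ↔ Odd (s.filter fun i => Odd (f i)).card := by
  classical
  have hmod : (∑ i ∈ s, f i) % 2 = (s.filter fun i => Odd (f i)).card % 2 := by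
    rw [Finset.sum_nat_mod, Finset.card_filter]
    congr 1
    refine Finset.sum_congr rfl fun i _ => ?_
    rcases Nat.mod_two_eq_zero_or_one (f i) with h | h
    · rw [h, if_neg (by rw [Nat.odd_iff]; omega)]
    · rw [h, if_pos (Nat.odd_iff.mpr h)]
  rw [Nat.odd_iff, Nat.odd_iff, hmod]

/-! ### The sign-at-the-ends lemma -/

/-- A real polynomial without roots in `(0, ∞)` has constant sign there (intermediate value theorem). [folklore] -/
private theorem eval_mul_eval_pos_of_no_pos_root (g : ℝ[X]) (hg : ∀ r, 0 < r → ¬ g.IsRoot r) {x y : ℝ}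
    (hx : 0 < x) (hy : 0 < y) : 0 < g.eval x * g.eval y := by
  have hcont : Continuous fun t => g.eval t := g.continuous
  have hx0 : g.eval x ≠ 0 := hg x hx
  have hy0 : g.eval y ≠ 0 := hg y hy
  -- no zero between x and y ⇒ same sign
  by_contra hle
  have hle : g.eval x * g.eval y ≤ 0 := le_of_not_gt hle
  have hopp : g.eval x * g.eval y < 0 := lt_of_le_of_ne hle (mul_ne_zero hx0 hy0)
  -- a zero exists on the segment between x and y
  have key : ∀ {a b : ℝ}, 0 < a → a ≤ b → g.eval a * g.eval b < 0 → False := by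
    intro a b ha hab hneg
    rcases lt_or_gt_of_ne (mul_ne_zero_iff.mp hneg.ne).1 with ha' | ha'
    · -- g a < 0 < g b
      have hb' : 0 < g.eval b := by nlinarith
      obtain ⟨z, hz, hz0⟩ := intermediate_value_Icc hab hcont.continuousOn ⟨ha'.le, hb'.le⟩
      exact hg z (lt_of_lt_of_le ha hz.1) hz0
    · have hb' : g.eval b < 0 := by nlinarith
      obtain ⟨z, hz, hz0⟩ := intermediate_value_Icc' hab hcont.continuousOn ⟨hb'.le, ha'.le⟩
      exact hg z (lt_of_lt_of_le ha hz.1) hz0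
  rcases le_total x y with hxy | hxy
  · exact key hx hxy hopp
  · exact key hy hxy (by rwa [mul_comm] at hopp)

/-- **Sign-at-the-ends lemma.**  If a real polynomial has a NEGATIVE GERM at `0⁺` — `p.coeff i = 0` for `i < k` and
`p.coeff k < 0` — then the number of its sign changes on `(0, ∞)` (`positiveSignChanges`) is odd iff its leading
coefficient is positive.  (Mechanism N-3 (iii) of the census: (G) ∧ (S∞) ⇒ (P).) [folklore] -/
theorem odd_positiveSignChanges_iff_leadingCoeff_pos {p : ℝ[X]} {k : ℕ} (hlow : ∀ i, i < k → p.coeff i = 0)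
    (hk : p.coeff k < 0) : Odd (positiveSignChanges p) ↔ 0 < p.leadingCoeff := by
  classical
  have hp : p ≠ 0 := fun h => by simp [h] at hk
  -- the multiset of positive roots and the factor F = ∏ (X − a)
  set S : Multiset ℝ := p.roots.filter fun a => 0 < a with hS
  set F : ℝ[X] := (S.map fun a => X - C a).prod with hF
  have hSpos : ∀ a ∈ S, 0 < a := fun a ha => (Multiset.mem_filter.mp ha).2
  have hFdvd : F ∣ p :=
    dvd_trans (Multiset.prod_dvd_prod_of_le (Multiset.map_le_map (Multiset.filter_le _ p.roots)))
      (prod_multiset_X_sub_C_dvd p)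
  obtain ⟨g, hpg⟩ := hFdvd
  have hFg0 : F * g ≠ 0 := hpg ▸ hp
  have hg0 : g ≠ 0 := right_ne_zero_of_mul hFg0
  have hFroots : F.roots = S := roots_multiset_prod_X_sub_C S
  -- g has no positive root
  have hgroot : ∀ r, 0 < r → ¬ g.IsRoot r := by
    intro r hr hgr
    have hmul : p.rootMultiplicity r = F.rootMultiplicity r + g.rootMultiplicity r := by
      rw [hpg]; exact rootMultiplicity_mul hFg0
    have hFr : F.rootMultiplicity r = p.rootMultiplicity r := by
      rw [← count_roots, ← count_roots, hFroots, hS, Multiset.count_filter_of_pos hr]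
    have hgpos : 0 < g.rootMultiplicity r := (rootMultiplicity_pos hg0).mpr hgr
    omega
  -- a point x₀ below every positive root with p x₀ < 0 (negative germ)
  obtain ⟨q, hq⟩ : X ^ k ∣ p := X_pow_dvd_iff.mpr hlow
  have hq0 : q.eval 0 < 0 := by
    have : p.coeff k = q.coeff 0 := by rw [hq, coeff_X_pow_mul', if_pos le_rfl, Nat.sub_self]
    rw [← coeff_zero_eq_eval_zero, ← this]; exact hk
  have hgerm : ∀ᶠ x in 𝓝[>] (0 : ℝ), p.eval x < 0 := by
    have h1 : ∀ᶠ x in 𝓝 (0 : ℝ), q.eval x < 0 :=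
      (q.continuous.tendsto 0).eventually (eventually_lt_nhds hq0)
    filter_upwards [nhdsWithin_le_nhds h1, self_mem_nhdsWithin] with x hx hx0
    rw [hq, eval_mul, eval_pow, eval_X]
    exact mul_neg_of_pos_of_neg (pow_pos hx0 k) hx
  have hbelow : ∀ᶠ x in 𝓝[>] (0 : ℝ), ∀ a ∈ S.toFinset, x < a := by
    refine (S.toFinset.eventually_all).mpr fun a ha => ?_
    exact nhdsWithin_le_nhds (eventually_lt_nhds (hSpos a (Multiset.mem_toFinset.mp ha)))
  obtain ⟨x₀, hpx₀, hx₀S, hx₀⟩ := (hgerm.and (hbelow.and self_mem_nhdsWithin)).exists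
  have hx₀ : 0 < x₀ := hx₀
  -- a point x₂ above every positive root where p has the sign of its leading coefficient
  have htop : ∀ᶠ x in atTop, 0 < p.leadingCoeff * p.eval x := by
    rcases Nat.eq_zero_or_pos p.natDegree with hdeg | hdeg
    · -- constant polynomial
      have hpc : p = C (p.coeff 0) := eq_C_of_natDegree_eq_zero hdeg
      have hlc : p.leadingCoeff = p.coeff 0 := by rw [leadingCoeff, hdeg]
      refine Eventually.of_forall fun x => ?_
      rw [hlc, hpc, eval_C, coeff_C_zero]
      have h0 : p.coeff 0 ≠ 0 := fun h => hp (by rw [hpc, h, C_0])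
      exact mul_self_pos.mpr h0
    · have hdeg' : 0 < p.degree := natDegree_pos_iff_degree_pos.mp hdeg
      rcases lt_or_gt_of_ne (leadingCoeff_ne_zero.mpr hp) with hlc | hlc
      · have ht := p.tendsto_atBot_of_leadingCoeff_nonpos hdeg' hlc.le
        filter_upwards [ht.eventually (eventually_lt_atBot 0)] with x hx
        exact mul_pos_of_neg_of_neg hlc hx
      · have ht := p.tendsto_atTop_of_leadingCoeff_nonneg hdeg' hlc.le
        filter_upwards [ht.eventually (eventually_gt_atTop 0)] with x hx
        exact mul_pos hlc hx
  have habove : ∀ᶠ x in atTop, ∀ a ∈ S.toFinset, a < x :=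
    (S.toFinset.eventually_all).mpr fun a _ => eventually_gt_atTop a
  obtain ⟨x₂, hpx₂, hx₂S, hx₂⟩ := (htop.and (habove.and (eventually_gt_atTop 0))).exists
  -- signs of F at x₀ and x₂
  have hF₂ : 0 < F.eval x₂ := by
    rw [hF, eval_multiset_prod_X_sub_C]
    exact multiset_prod_map_pos S _ fun a ha => sub_pos.mpr (hx₂S a (Multiset.mem_toFinset.mpr ha))
  have hF₀ : 0 < (-1 : ℝ) ^ Multiset.card S * F.eval x₀ := by
    rw [hF, eval_multiset_prod_X_sub_C, multiset_prod_map_sub, ← mul_assoc, ← mul_pow, neg_one_mul, neg_neg, one_pow,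
      one_mul]
    exact multiset_prod_map_pos S _ fun a ha => sub_pos.mpr (hx₀S a (Multiset.mem_toFinset.mpr ha))
  -- g has the same sign at x₀ and x₂
  have hgg : 0 < g.eval x₀ * g.eval x₂ := eval_mul_eval_pos_of_no_pos_root g hgroot hx₀ hx₂
  -- hence sign (p x₀ · p x₂) = (−1)^{|S|}
  have hprod : 0 < (-1 : ℝ) ^ Multiset.card S * (p.eval x₀ * p.eval x₂) := by
    have : (-1 : ℝ) ^ Multiset.card S * (p.eval x₀ * p.eval x₂) =
        ((-1 : ℝ) ^ Multiset.card S * F.eval x₀) * F.eval x₂ * (g.eval x₀ * g.eval x₂) := by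
      rw [hpg, eval_mul, eval_mul]; ring
    rw [this]; positivity
  -- parity bookkeeping: |S| ≡ positiveSignChanges p (mod 2)
  have hcard : Odd (Multiset.card S) ↔ Odd (positiveSignChanges p) := by
    have h1 : Multiset.card S = ∑ r ∈ S.toFinset, p.rootMultiplicity r := by
      rw [← Multiset.toFinset_sum_count_eq]
      refine Finset.sum_congr rfl fun r hr => ?_
      rw [hS, Multiset.count_filter_of_pos (hSpos r (Multiset.mem_toFinset.mp hr)), count_roots]
    have h2 : S.toFinset = p.roots.toFinset.filter fun r => 0 < r := by
      rw [hS, Multiset.toFinset_filter]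
    rw [h1, odd_sum_iff_odd_card_filter_odd, h2, Finset.filter_filter]
    rfl
  -- conclude: p x₀ < 0, sign p x₂ = sign lc
  rw [← hcard]
  constructor
  · intro hodd
    rw [hodd.neg_one_pow] at hprod
    -- p x₀ * p x₂ < 0 with p x₀ < 0 ⇒ p x₂ > 0 ⇒ lc > 0
    have hx₂pos : 0 < p.eval x₂ := by nlinarith
    exact (pos_iff_pos_of_mul_pos hpx₂).mpr hx₂pos
  · intro hlc
    have hx₂pos : 0 < p.eval x₂ := (pos_iff_pos_of_mul_pos hpx₂).mp hlc
    by_contra heven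
    rw [Nat.not_odd_iff_even] at heven
    rw [heven.neg_one_pow, one_mul] at hprod
    nlinarith

end Summit.Ventures.YMGap.Census

end
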